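/-
Summits.KontsevichZagierPeriods.HardCores — GENERATED by harness/kit/hardcore_registry.py (2026-08-18T11:48:14Z) from harness/kit/hardcore_seeds.json (FILTER-SYNTHESIS 2026-08-18 F1).
Tags existing OPEN statement items as famous open sub-summit problems (`@[hard_core]`); the kernel tribunal (t1h) flags routes whose crux meets one
(frontier shelf, never a fail; the owner route is exempt). 6 item(s) tagged; 0 unresolved: []
NEVER import this from a Theorems/Theses/Cruxes file.
-/
import Summits.KontsevichZagierPeriods.KontsevichZagierPeriods.Theses.AyoubSpecialisation
import Summits.KontsevichZagierPeriods.KontsevichZagierPeriods.Theses.BianchiHumbert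
import Summits.KontsevichZagierPeriods.KontsevichZagierPeriods.Theses.AbelContraction
import Summits.KontsevichZagierPeriods.KontsevichZagierPeriods.Theses.LinRedNormalForm
import Summits.KontsevichZagierPeriods.KontsevichZagierPeriods.Theses.HyperbolicBloch
import Summits.KontsevichZagierPeriods.KontsevichZagierPeriods.Theses.InverseLandau
import HarnessLib.Audit.TribunalTags

-- stmt-KontsevichZagierPeriods-0540 · ayoub_piCancellation · Ayoub pi-cancellation
attribute [hard_core "KontsevichZagierPeriods" "Ayoub pi-cancellation"] Summit.KontsevichZagierPeriods.KontsevichZagierPeriods.Theses.AyoubSpecialisation.AyoubPiCancellation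
-- stmt-KontsevichZagierPeriods-4280 · KZDimTwo · KZ in dimension two
attribute [hard_core "KontsevichZagierPeriods" "KZ in dimension two"] Summit.KontsevichZagierPeriods.KontsevichZagierPeriods.Theses.BianchiHumbert.KZDimTwo
-- stmt-KontsevichZagierPeriods-18030 · ReductionToDimensionTwo · KZ in dimension two
attribute [hard_core "KontsevichZagierPeriods" "KZ in dimension two"] Summit.KontsevichZagierPeriods.KontsevichZagierPeriods.Theses.AbelContraction.ReductionToDimensionTwo
-- stmt-KontsevichZagierPeriods-15045 · HoffmanIndependence · Hoffman independence / Zagier dilogarithm / Tate lifting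
attribute [hard_core "KontsevichZagierPeriods" "Hoffman independence / Zagier dilogarithm / Tate lifting"] Summit.KontsevichZagierPeriods.KontsevichZagierPeriods.Theses.LinRedNormalForm.HoffmanIndependence
-- stmt-KontsevichZagierPeriods-10550 · ZagierDilogarithmConjecture · Hoffman independence / Zagier dilogarithm / Tate lifting
attribute [hard_core "KontsevichZagierPeriods" "Hoffman independence / Zagier dilogarithm / Tate lifting"] Summit.KontsevichZagierPeriods.KontsevichZagierPeriods.Theses.HyperbolicBloch.ZagierDilogarithmConjecture
-- stmt-KontsevichZagierPeriods-9129 · TateLifting · Hoffman independence / Zagier dilogarithm / Tate lifting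
attribute [hard_core "KontsevichZagierPeriods" "Hoffman independence / Zagier dilogarithm / Tate lifting"] Summit.KontsevichZagierPeriods.KontsevichZagierPeriods.Theses.InverseLandau.TateLifting
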